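import Summits.QuantumFields.YangMills.Theorems.LuscherReductionRunningReductionLatticeLargeField
import Summits.QuantumFields.YangMills.Theorems.FemtoTransferGapSlabRayleigh
import Literature.Analysis.OperatorTheory.SchurTestKernel
import HarnessLib

/-!
# COARSE-LOWER(L₁) of S-BASE (crux `TwistedTraceScaling`, stmt-QuantumFields-20203, line «twolattice»): the two VARIATIONAL DOORS
# on the torus `(ℤ/L)³` — a positive SUPERSOLUTION bounds `λ₀` from above (weighted Schur test), the GROUND-STATE TRANSFORM bounds `λ_k`
# from below (Courant–Fischer on `a·h`) — and the reduction of the tree hypothesis `hLow` of `TwoLattice.Base.fixedLatticeTraceLaw_of_coarse`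

Lane B («VARIATIONAL LOWER + TAIL», seat ym-20203-coarse-s1) of the cut S-BASE ⇐ COARSE-UPPER/LOWER/TAIL(L₁)
(`Theorems/LuscherReductionTwistedTraceScalingBaseOfCoarse.lean`).  COARSE-LOWER(L₁) is the RATIO statement
`e^{−(Δ_k+ε)u} λ₀ ≤ λ_k` (`u = Λ(β,L₁)/L₁`, deep in the femto window at fixed `L₁`).  This module proves, for EVERY lattice size `L`, every
`β ≥ 0` and the `SU(2)` zero-flux transfer kernel `K_β` of the tree, the two abstract doors through which such a ratio bound is obtained
WITHOUT computing any Gaussian normalisation (the common prefactor `Λ` cancels):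

* §1 `qform_le_of_supersolution`, `levelValue_zero_le_of_supersolution` — if `h` is measurable with `0 < c ≤ h ≤ C` and
  `(K_β h)(U) ≤ Λ·h(U)` for every `U` (a positive SUPERSOLUTION; `h` need not be physical), then `⟨ψ,K_βψ⟩ ≤ Λ‖ψ‖²` for every physical `ψ`
  and `λ₀(β,L) ≤ Λ` — the weighted Schur test of the tree (`Literature.Analysis.OperatorTheory.SchurTest`, Helffer Lemma 7.1 /
  Grafakos App. A.2) specialised to the transfer kernel, plus the `k = 0` inf–sup door `levelValue_zero_le_of_forall_rayleigh_le`.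
* §2 `qform_mul_mul_eq` — the GROUND-STATE-TRANSFORM IDENTITY for kernels: for bounded measurable `a`, `h`,
  `⟨ah, K_β(ah)⟩ = ∫ a² · h·(K_β h) − ½ ∫∫ h(U) K_β(U,V) h(V) (a(U) − a(V))²`
  (pointwise `xy = ½x² + ½y² − ½(x−y)²`, Fubini, symmetry of `K_β`).
* §3 `le_levelValue_of_groundStateTransform` — if `h` is PHYSICAL, `A` is a `(k+1)`-dimensional space of physical multipliers `a` with
  `Λ'·∫a²h² ≤ ∫ a² h (K_β h)` (integrated SUB-solution bound), `½∫∫ hK_βh (a(U)−a(V))² ≤ δ·∫a²h²` (DIRICHLET bound) and `∫a²h² > 0` for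
  `a ≠ 0`, then `Λ' − δ ≤ λ_k(β,L)` (tree door `le_levelValue_of_subspace` on `W = {a·h}`); §4 `integral_sq_mul_transferApply_ge` derives the
  integrated sub-solution bound from a POINTWISE one `Λ'h ≤ K_βh` on a bulk set `B` plus a mass bound off `B`.
* §5 `coarseLower_of_doors (L1)` — conclusion = VERBATIM the hypothesis `hLow` of `Base.fixedLatticeTraceLaw_of_coarse L1`, from: for every
  `k`, `ε > 0`, deep in the window, numbers `Λ, Λ', δ` with `λ₀ ≤ Λ`, `Λ' − δ ≤ λ_k` and `e^{−(Δ_k+ε)Λ(β,L₁)/L₁}·Λ ≤ Λ' − δ`.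

So `hLow` is REDUCED to four estimates about ONE positive physical approximate ground state `h` (intended: gauge average of the adiabatic
stiff Gaussian ⊗ pulled-back `𝔥` ground state) and multipliers `a_j` (pulled-back `f_j/f_0`): H-SUP, H-SUB (bulk), DIRICHLET, MASS.  HONEST
FRAMING: doors only — none of the four estimates is proved here; femto rung R2b1 (stub of a child of a CONDITIONAL route); not a gap, not Clay.
-/

set_option autoImplicit false

noncomputable section

open MeasureTheory Filter Topology Real
open scoped BigOperators
open Literature.MathematicalPhysics.QuantumFieldTheory
open Literature.MathematicalPhysics.QuantumLattice
open Literature.Analysis.OperatorTheory.YMMatrixModel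

namespace Summit.QuantumFields.YangMills.Theorems.FemtoTransferGap.TwoLattice.Lower

open Summit.QuantumFields.YangMills.Theorems.FemtoTransferGap

variable {L : ℕ} [NeZero L]

/-! ## §0 Bounded-measurable bookkeeping -/

/-- `K_β h ≥ 0` pointwise for `h ≥ 0`. [folklore] -/
theorem transferApply_nonneg (β : ℝ) {h : GaugeConfig 3 L SU2 → ℝ} (hh0 : ∀ U, 0 ≤ h U) (U : GaugeConfig 3 L SU2) :
    0 ≤ transferApply β h U :=
  integral_nonneg fun V => mul_nonneg (transferKernel_pos su2Rep β U V).le (hh0 V)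

/-- Positivity of the supersolution constant: if `h ≥ 0`, `0 < h(U)` and `(K_β h)(U) ≤ Λ h(U)` at one `U`, then `0 ≤ Λ`. [folklore] -/
theorem nonneg_of_supersolution_at (β : ℝ) {h : GaugeConfig 3 L SU2 → ℝ} (hh0 : ∀ U, 0 ≤ h U) {Λ : ℝ} (U : GaugeConfig 3 L SU2)
    (hU : 0 < h U) (hsup : transferApply β h U ≤ Λ * h U) : 0 ≤ Λ := by
  have h1 : 0 ≤ Λ * h U := (transferApply_nonneg β hh0 U).trans hsup
  by_contra hneg
  exact absurd h1 (not_le.mpr (mul_neg_of_neg_of_pos (not_le.mp hneg) hU))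

/-- `⟨f, K_β f'⟩` as a product integral for bounded measurable `f, f'` (`β ≥ 0`). [folklore] -/
theorem qform_eq_integral_prod_of_bounded {β : ℝ} (hβ : 0 ≤ β) {f f' : GaugeConfig 3 L SU2 → ℝ} (hf : Measurable f) (hf' : Measurable f')
    {C C' : ℝ} (hfb : ∀ U, |f U| ≤ C) (hf'b : ∀ U, |f' U| ≤ C') :
    qform su2Rep β f f' = ∫ p, f p.1 * transferKernel su2Rep β p.1 p.2 * f' p.2
      ∂(configMeasure SU2 L).prod (configMeasure SU2 L) :=
  (integral_prod _ (integrable_latSandwich (measurable_transferKernel_lat β) (abs_transferKernel_le_lat hβ) hf hf' hfb hf'b)).symm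

/-- `l2 (a h) (a h) = ∫ a² h²`. [folklore] -/
theorem l2_mul_mul_eq (a h : GaugeConfig 3 L SU2 → ℝ) :
    l2 (a * h) (a * h) = ∫ U, a U ^ 2 * h U ^ 2 ∂configMeasure SU2 L := by
  unfold l2
  refine integral_congr_ae (ae_of_all _ fun U => ?_)
  simp only [Pi.mul_apply]
  ring

/-! ## §1 The supersolution door: `K_β h ≤ Λ h` with `h > 0` bounds every Rayleigh quotient, hence `λ₀`, by `Λ` -/

/-- **Weighted Schur test for the transfer form.**  If `h` is measurable with `0 < c ≤ h ≤ C` and `(K_β h)(U) ≤ Λ·h(U)` for every `U`, then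
`⟨ψ, K_β ψ⟩ ≤ Λ ‖ψ‖²` for every physical zero-flux `ψ` (`β ≥ 0`; the kernel is symmetric, so one row inequality suffices).
[cite: Helffer2013, Lemma 7.1] [cite: Grafakos2009, App. A.2] -/
theorem qform_le_of_supersolution {β : ℝ} (hβ : 0 ≤ β) {h : GaugeConfig 3 L SU2 → ℝ} (hm : Measurable h) {c C : ℝ} (hc : 0 < c)
    (hch : ∀ U, c ≤ h U) (hhC : ∀ U, h U ≤ C) {Λ : ℝ} (hsup : ∀ U, transferApply β h U ≤ Λ * h U)
    {ψ : GaugeConfig 3 L SU2 → ℝ} (hψ : IsPhys ψ) :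
    qform su2Rep β ψ ψ ≤ Λ * l2 ψ ψ := by
  obtain ⟨Cψ, hCψ⟩ := hψ.bounded
  have hψm := hψ.measurable
  have hpos : ∀ U, 0 < h U := fun U => hc.trans_le (hch U)
  have hC0 : 0 ≤ C := (hpos _).le.trans (hhC (fun _ => 1))
  set M : ℝ := Real.exp (2 * β) ^ Fintype.card (Edge 3 L) with hMdef
  have hKle : ∀ p : GaugeConfig 3 L SU2 × GaugeConfig 3 L SU2, |transferKernel su2Rep β p.1 p.2| ≤ M := abs_transferKernel_le_lat hβ
  -- integrability side conditions
  have hψ2 : Integrable (fun U => ψ U ^ 2) (configMeasure SU2 L) := by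
    refine Integrable.mono' (integrable_const (Cψ ^ 2)) (hψm.pow_const 2).aestronglyMeasurable (ae_of_all _ fun U => ?_)
    rw [Real.norm_eq_abs, abs_pow]; exact pow_le_pow_left₀ (abs_nonneg _) (hCψ U) 2
  have hI := integrable_latSandwich (measurable_transferKernel_lat β) (abs_transferKernel_le_lat hβ) hψm hψm hCψ hCψ
  have hquot : ∀ U V, |transferKernel su2Rep β U V * h V / h U| ≤ M * (C / c) := fun U V => by
    have hK := transferKernel_pos su2Rep β U V
    rw [abs_of_nonneg (div_nonneg (mul_nonneg hK.le (hpos V).le) (hpos U).le), mul_div_assoc]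
    exact mul_le_mul ((le_abs_self _).trans (hKle (U, V))) (div_le_div₀ hC0 (hhC V) hc (hch U)) (div_nonneg (hpos V).le (hpos U).le)
      ((transferKernel_pos su2Rep β (fun _ => 1) (fun _ => 1)).le.trans ((le_abs_self _).trans (hKle (_, _))))
  have hψ2b : ∀ U, |ψ U ^ 2| ≤ Cψ ^ 2 := fun U => by rw [abs_pow]; exact pow_le_pow_left₀ (abs_nonneg _) (hCψ U) 2
  have hI₁ : Integrable (fun p : GaugeConfig 3 L SU2 × GaugeConfig 3 L SU2 =>
      transferKernel su2Rep β p.1 p.2 * h p.2 / h p.1 * ψ p.1 ^ 2) ((configMeasure SU2 L).prod (configMeasure SU2 L)) := by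
    refine integrable_latProd ((((measurable_transferKernel_lat β).mul (hm.comp measurable_snd)).div (hm.comp measurable_fst)).mul
      ((hψm.comp measurable_fst).pow_const 2)) (C := M * (C / c) * Cψ ^ 2) fun p => ?_
    rw [abs_mul]
    exact mul_le_mul (hquot p.1 p.2) (hψ2b p.1) (abs_nonneg _) (by positivity)
  have hI₂ : Integrable (fun p : GaugeConfig 3 L SU2 × GaugeConfig 3 L SU2 =>
      transferKernel su2Rep β p.1 p.2 * h p.1 / h p.2 * ψ p.2 ^ 2) ((configMeasure SU2 L).prod (configMeasure SU2 L)) := by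
    refine integrable_latProd ((((measurable_transferKernel_lat β).mul (hm.comp measurable_fst)).div (hm.comp measurable_snd)).mul
      ((hψm.comp measurable_snd).pow_const 2)) (C := M * (C / c) * Cψ ^ 2) fun p => ?_
    rw [abs_mul]
    have hq : |transferKernel su2Rep β p.1 p.2 * h p.1 / h p.2| ≤ M * (C / c) := by
      rw [transferKernel_su2Rep_symm]; exact hquot p.2 p.1
    exact mul_le_mul hq (hψ2b p.2) (abs_nonneg _) (by positivity)
  have hrow : ∀ᵐ U ∂configMeasure SU2 L, ∫ V, transferKernel su2Rep β U V * h V ∂configMeasure SU2 L ≤ Λ * h U :=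
    ae_of_all _ fun U => by rw [← transferApply_apply]; exact hsup U
  have hmain := Literature.Analysis.OperatorTheory.SchurTest.integral_integral_mul_kernel_mul_self_le_weighted_of_symm
    (μ := configMeasure SU2 L) (fun U V => transferKernel su2Rep β U V) ψ h
    (fun U V => (transferKernel_pos su2Rep β U V).le) (fun U V => transferKernel_su2Rep_symm β U V) hpos hrow hψ2 hI hI₁ hI₂
  have hl2 : l2 ψ ψ = ∫ U, ψ U ^ 2 ∂configMeasure SU2 L := by
    unfold l2; refine integral_congr_ae (ae_of_all _ fun U => ?_); ring
  rw [hl2]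
  exact hmain

/-- ★ **SUPERSOLUTION DOOR for the top value.**  A measurable `h` with `0 < c ≤ h ≤ C` and `K_β h ≤ Λ h` pointwise gives `λ₀(β, L) ≤ Λ`
(`levelValue su2Rep L β 0 ≤ Λ`; `β ≥ 0`, every `L`).  For `h` the exact positive ground state, `Λ = λ₀` (sharp); `h` need NOT be physical.
[cite: Helffer2013, Lemma 7.1] [cite: ReedSimonIV1978, Thm. XIII.1] -/
theorem levelValue_zero_le_of_supersolution {β : ℝ} (hβ : 0 ≤ β) {h : GaugeConfig 3 L SU2 → ℝ} (hm : Measurable h) {c C : ℝ}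
    (hc : 0 < c) (hch : ∀ U, c ≤ h U) (hhC : ∀ U, h U ≤ C) {Λ : ℝ} (hsup : ∀ U, transferApply β h U ≤ Λ * h U) :
    levelValue su2Rep L β 0 ≤ Λ := by
  have hΛ : 0 ≤ Λ := nonneg_of_supersolution_at β (fun U => (hc.trans_le (hch U)).le) (fun _ => 1)
    (hc.trans_le (hch _)) (hsup _)
  exact levelValue_zero_le_of_forall_rayleigh_le su2Rep β hΛ fun ψ hψ _ => qform_le_of_supersolution hβ hm hc hch hhC hsup hψ

/-! ## §2 The ground-state-transform identity for the transfer kernel -/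

omit [NeZero L] in
/-- Pointwise: `(a h)(U) K (a h)(V) = ½a(U)²·hKh + ½a(V)²·hKh − ½ hKh·(a(U) − a(V))²`. [folklore] -/
theorem gst_pointwise (a h : GaugeConfig 3 L SU2 → ℝ) (K : ℝ) (U V : GaugeConfig 3 L SU2) :
    (a * h) U * K * (a * h) V =
      (1 / 2 : ℝ) * (a U ^ 2 * (h U * K * h V)) + (1 / 2 : ℝ) * (a V ^ 2 * (h U * K * h V))
        - (1 / 2 : ℝ) * (h U * K * h V * (a U - a V) ^ 2) := by
  simp only [Pi.mul_apply]; ring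

/-- `∫∫ a(U)² h(U) K_β(U,V) h(V) = ∫ a² · h · (K_β h)`. [folklore] -/
theorem integral_prod_sq_fst_mul {β : ℝ} (hβ : 0 ≤ β) {a h : GaugeConfig 3 L SU2 → ℝ} (ham : Measurable a) (hhm : Measurable h)
    {Ca Ch : ℝ} (hab : ∀ U, |a U| ≤ Ca) (hhb : ∀ U, |h U| ≤ Ch) :
    ∫ p, a p.1 ^ 2 * (h p.1 * transferKernel su2Rep β p.1 p.2 * h p.2) ∂(configMeasure SU2 L).prod (configMeasure SU2 L) =
      ∫ U, a U ^ 2 * (h U * transferApply β h U) ∂configMeasure SU2 L := by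
  have ha2m : Measurable fun U => a U ^ 2 := ham.pow_const 2
  have ha2b : ∀ U, |a U ^ 2| ≤ Ca ^ 2 := fun U => by rw [abs_pow]; exact pow_le_pow_left₀ (abs_nonneg _) (hab U) 2
  have hint : Integrable (fun p : GaugeConfig 3 L SU2 × GaugeConfig 3 L SU2 =>
      a p.1 ^ 2 * (h p.1 * transferKernel su2Rep β p.1 p.2 * h p.2)) ((configMeasure SU2 L).prod (configMeasure SU2 L)) := by
    have h1 := integrable_latSandwich (measurable_transferKernel_lat β) (abs_transferKernel_le_lat hβ) hhm hhm hhb hhb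
    refine (h1.bdd_mul (c := Ca ^ 2) (ha2m.comp measurable_fst).aestronglyMeasurable (ae_of_all _ fun p => ?_))
    rw [Real.norm_eq_abs]; exact ha2b p.1
  rw [integral_prod _ hint]
  refine integral_congr_ae (ae_of_all _ fun U => ?_)
  simp only
  rw [integral_const_mul, transferApply_apply, ← integral_const_mul (h U)]
  congr 1
  refine integral_congr_ae (ae_of_all _ fun V => ?_)
  ring

/-- `∫∫ a(V)² h(U) K_β(U,V) h(V) = ∫ a² · h · (K_β h)` (swap the variables; `K_β` is symmetric). [folklore] -/
theorem integral_prod_sq_snd_mul {β : ℝ} (hβ : 0 ≤ β) {a h : GaugeConfig 3 L SU2 → ℝ} (ham : Measurable a) (hhm : Measurable h)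
    {Ca Ch : ℝ} (hab : ∀ U, |a U| ≤ Ca) (hhb : ∀ U, |h U| ≤ Ch) :
    ∫ p, a p.2 ^ 2 * (h p.1 * transferKernel su2Rep β p.1 p.2 * h p.2) ∂(configMeasure SU2 L).prod (configMeasure SU2 L) =
      ∫ U, a U ^ 2 * (h U * transferApply β h U) ∂configMeasure SU2 L := by
  rw [← integral_prod_sq_fst_mul hβ ham hhm hab hhb, ← integral_prod_swap]
  refine integral_congr_ae (ae_of_all _ fun p => ?_)
  simp only [Prod.fst_swap, Prod.snd_swap, transferKernel_su2Rep_symm β p.2 p.1]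
  ring

/-- ★ **GROUND-STATE-TRANSFORM IDENTITY.**  For bounded measurable `a`, `h` and `β ≥ 0`:
`⟨ah, K_β(ah)⟩ = ∫ a²·h·(K_β h) − ½ ∫∫ h(U) K_β(U,V) h(V) (a(U) − a(V))²`.
With `h` an exact eigenfunction (`K_βh = λ₀h`) this is the Dirichlet-form representation `λ₀‖ah‖² − ½∫∫hK_βh(δa)²` of the quadratic form on
multipliers of the ground state. [cite: GlimmJaffe1987, §3.2] -/
theorem qform_mul_mul_eq {β : ℝ} (hβ : 0 ≤ β) {a h : GaugeConfig 3 L SU2 → ℝ} (ham : Measurable a) (hhm : Measurable h)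
    {Ca Ch : ℝ} (hab : ∀ U, |a U| ≤ Ca) (hhb : ∀ U, |h U| ≤ Ch) :
    qform su2Rep β (a * h) (a * h) =
      (∫ U, a U ^ 2 * (h U * transferApply β h U) ∂configMeasure SU2 L) -
        (1 / 2 : ℝ) * ∫ p, h p.1 * transferKernel su2Rep β p.1 p.2 * h p.2 * (a p.1 - a p.2) ^ 2
          ∂(configMeasure SU2 L).prod (configMeasure SU2 L) := by
  have hahm : Measurable (a * h) := ham.mul hhm
  have hCa : 0 ≤ Ca := (abs_nonneg _).trans (hab fun _ => 1)
  have hahb : ∀ U, |(a * h) U| ≤ Ca * Ch := fun U => by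
    rw [Pi.mul_apply, abs_mul]; exact mul_le_mul (hab U) (hhb U) (abs_nonneg _) hCa
  rw [qform_eq_integral_prod_of_bounded hβ hahm hahm hahb hahb]
  have ha2m : Measurable fun U => a U ^ 2 := ham.pow_const 2
  have ha2b : ∀ U, |a U ^ 2| ≤ Ca ^ 2 := fun U => by rw [abs_pow]; exact pow_le_pow_left₀ (abs_nonneg _) (hab U) 2
  have hS := integrable_latSandwich (L := L) (measurable_transferKernel_lat β) (abs_transferKernel_le_lat hβ) hhm hhm hhb hhb
  have hT1 : Integrable (fun p : GaugeConfig 3 L SU2 × GaugeConfig 3 L SU2 =>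
      a p.1 ^ 2 * (h p.1 * transferKernel su2Rep β p.1 p.2 * h p.2)) ((configMeasure SU2 L).prod (configMeasure SU2 L)) :=
    hS.bdd_mul (c := Ca ^ 2) (ha2m.comp measurable_fst).aestronglyMeasurable (ae_of_all _ fun p => by
      rw [Real.norm_eq_abs]; exact ha2b p.1)
  have hT2 : Integrable (fun p : GaugeConfig 3 L SU2 × GaugeConfig 3 L SU2 =>
      a p.2 ^ 2 * (h p.1 * transferKernel su2Rep β p.1 p.2 * h p.2)) ((configMeasure SU2 L).prod (configMeasure SU2 L)) :=
    hS.bdd_mul (c := Ca ^ 2) (ha2m.comp measurable_snd).aestronglyMeasurable (ae_of_all _ fun p => by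
      rw [Real.norm_eq_abs]; exact ha2b p.2)
  have hdm : Measurable fun p : GaugeConfig 3 L SU2 × GaugeConfig 3 L SU2 => (a p.1 - a p.2) ^ 2 :=
    ((ham.comp measurable_fst).sub (ham.comp measurable_snd)).pow_const 2
  have hdb : ∀ p : GaugeConfig 3 L SU2 × GaugeConfig 3 L SU2, |(a p.1 - a p.2) ^ 2| ≤ (2 * Ca) ^ 2 := fun p => by
    rw [abs_pow]
    refine pow_le_pow_left₀ (abs_nonneg _) ?_ 2
    calc |a p.1 - a p.2| ≤ |a p.1| + |a p.2| := abs_sub _ _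
      _ ≤ Ca + Ca := add_le_add (hab _) (hab _)
      _ = 2 * Ca := by ring
  have hT3 : Integrable (fun p : GaugeConfig 3 L SU2 × GaugeConfig 3 L SU2 =>
      h p.1 * transferKernel su2Rep β p.1 p.2 * h p.2 * (a p.1 - a p.2) ^ 2) ((configMeasure SU2 L).prod (configMeasure SU2 L)) :=
    hS.mul_bdd (c := (2 * Ca) ^ 2) hdm.aestronglyMeasurable (ae_of_all _ fun p => by rw [Real.norm_eq_abs]; exact hdb p)
  have hpt : ∀ p : GaugeConfig 3 L SU2 × GaugeConfig 3 L SU2,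
      (a * h) p.1 * transferKernel su2Rep β p.1 p.2 * (a * h) p.2 =
        (1 / 2 : ℝ) * (a p.1 ^ 2 * (h p.1 * transferKernel su2Rep β p.1 p.2 * h p.2)) +
          (1 / 2 : ℝ) * (a p.2 ^ 2 * (h p.1 * transferKernel su2Rep β p.1 p.2 * h p.2)) -
            (1 / 2 : ℝ) * (h p.1 * transferKernel su2Rep β p.1 p.2 * h p.2 * (a p.1 - a p.2) ^ 2) :=
    fun p => gst_pointwise a h _ p.1 p.2
  simp_rw [hpt]
  have hT1' : Integrable (fun p : GaugeConfig 3 L SU2 × GaugeConfig 3 L SU2 =>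
      (1 / 2 : ℝ) * (a p.1 ^ 2 * (h p.1 * transferKernel su2Rep β p.1 p.2 * h p.2)))
      ((configMeasure SU2 L).prod (configMeasure SU2 L)) := hT1.const_mul _
  have hT2' : Integrable (fun p : GaugeConfig 3 L SU2 × GaugeConfig 3 L SU2 =>
      (1 / 2 : ℝ) * (a p.2 ^ 2 * (h p.1 * transferKernel su2Rep β p.1 p.2 * h p.2)))
      ((configMeasure SU2 L).prod (configMeasure SU2 L)) := hT2.const_mul _
  have hT3' : Integrable (fun p : GaugeConfig 3 L SU2 × GaugeConfig 3 L SU2 =>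
      (1 / 2 : ℝ) * (h p.1 * transferKernel su2Rep β p.1 p.2 * h p.2 * (a p.1 - a p.2) ^ 2))
      ((configMeasure SU2 L).prod (configMeasure SU2 L)) := hT3.const_mul _
  have hT12 : Integrable (fun p : GaugeConfig 3 L SU2 × GaugeConfig 3 L SU2 =>
      (1 / 2 : ℝ) * (a p.1 ^ 2 * (h p.1 * transferKernel su2Rep β p.1 p.2 * h p.2)) +
        (1 / 2 : ℝ) * (a p.2 ^ 2 * (h p.1 * transferKernel su2Rep β p.1 p.2 * h p.2)))
      ((configMeasure SU2 L).prod (configMeasure SU2 L)) := hT1'.add hT2'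
  rw [integral_sub hT12 hT3', integral_add hT1' hT2', integral_const_mul, integral_const_mul, integral_const_mul,
    integral_prod_sq_fst_mul hβ ham hhm hab hhb, integral_prod_sq_snd_mul hβ ham hhm hab hhb]
  ring

/-- Corollary (DIRICHLET form is a deficit): `⟨ah, K_β(ah)⟩ ≥ ∫ a²h(K_βh) − D` whenever `½∫∫ hK_βh (a(U)−a(V))² ≤ D`. [folklore] -/
theorem qform_mul_mul_ge {β : ℝ} (hβ : 0 ≤ β) {a h : GaugeConfig 3 L SU2 → ℝ} (ham : Measurable a) (hhm : Measurable h)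
    {Ca Ch : ℝ} (hab : ∀ U, |a U| ≤ Ca) (hhb : ∀ U, |h U| ≤ Ch) {D : ℝ}
    (hD : (1 / 2 : ℝ) * ∫ p, h p.1 * transferKernel su2Rep β p.1 p.2 * h p.2 * (a p.1 - a p.2) ^ 2
      ∂(configMeasure SU2 L).prod (configMeasure SU2 L) ≤ D) :
    (∫ U, a U ^ 2 * (h U * transferApply β h U) ∂configMeasure SU2 L) - D ≤ qform su2Rep β (a * h) (a * h) := by
  rw [qform_mul_mul_eq hβ ham hhm hab hhb]; linarith

/-! ## §3 The ground-state-transform door: `Λ' − δ ≤ λ_k` from a `(k+1)`-dimensional space of physical multipliers of a physical `h` -/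

omit [NeZero L] in
/-- Products `a · h` of physical zero-flux test functions are physical. [folklore] -/
theorem isPhys_mul {a h : GaugeConfig 3 L SU2 → ℝ} (ha : IsPhys a) (hh : IsPhys h) : IsPhys (a * h) := by
  obtain ⟨Ca, hCa⟩ := ha.bounded
  exact IsPhys.mul_of_invariant hh ha.measurable hCa ha.gaugeInv ha.zeroFlux

/-- ★ **GROUND-STATE-TRANSFORM DOOR (Courant–Fischer on `W = {a·h}`).**  Let `h` be physical and `A` a `(k+1)`-dimensional space of
physical multipliers such that for every `a ∈ A`: (SUB) `Λ'·∫a²h² ≤ ∫ a²·h·(K_βh)`; (DIRICHLET) `½∫∫ h(U)K_β(U,V)h(V)(a(U)−a(V))² ≤ δ·∫a²h²`;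
(NONDEGENERATE) `∫a²h² > 0` unless `a = 0`.  Then `Λ' − δ ≤ λ_k(β, L)` (`β ≥ 0`, every `L`). [cite: ReedSimonIV1978, Thm. XIII.1–2]
[cite: GlimmJaffe1987, §3.2] -/
theorem le_levelValue_of_groundStateTransform {β : ℝ} (hβ : 0 ≤ β) {k : ℕ} {h : GaugeConfig 3 L SU2 → ℝ} (hh : IsPhys h)
    (A : Submodule ℝ (GaugeConfig 3 L SU2 → ℝ)) (hA : Module.finrank ℝ A = k + 1) (hAphys : ∀ a ∈ A, IsPhys a) {Λ' δ : ℝ}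
    (hsub : ∀ a ∈ A, Λ' * ∫ U, a U ^ 2 * h U ^ 2 ∂configMeasure SU2 L ≤ ∫ U, a U ^ 2 * (h U * transferApply β h U) ∂configMeasure SU2 L)
    (hdir : ∀ a ∈ A, (1 / 2 : ℝ) * ∫ p, h p.1 * transferKernel su2Rep β p.1 p.2 * h p.2 * (a p.1 - a p.2) ^ 2
      ∂(configMeasure SU2 L).prod (configMeasure SU2 L) ≤ δ * ∫ U, a U ^ 2 * h U ^ 2 ∂configMeasure SU2 L)
    (hnd : ∀ a ∈ A, a ≠ 0 → 0 < ∫ U, a U ^ 2 * h U ^ 2 ∂configMeasure SU2 L) :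
    Λ' - δ ≤ levelValue su2Rep L β k := by
  obtain ⟨Ch, hCh⟩ := hh.bounded
  -- the trial space `W = (a ↦ a·h)(A)`
  -- `a ↦ a·h` is Mathlib's right multiplication `LinearMap.mulRight ℝ h` in the algebra of real functions
  set f : A →ₗ[ℝ] (GaugeConfig 3 L SU2 → ℝ) := (LinearMap.mulRight ℝ h).domRestrict A with hfdef
  have hf : ∀ a : A, f a = (a : GaugeConfig 3 L SU2 → ℝ) * h := fun a => by
    rw [hfdef, LinearMap.domRestrict_apply, LinearMap.mulRight_apply]
  have hinj : Function.Injective f := by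
    intro a b hab
    have hsub0 : f (a - b) = 0 := by rw [map_sub, hab, sub_self]
    by_contra hne
    have hne' : ((a - b : A) : GaugeConfig 3 L SU2 → ℝ) ≠ 0 := by
      intro h0; exact hne (sub_eq_zero.mp ((Submodule.coe_eq_zero).mp h0))
    have hpos := hnd _ (a - b).2 hne'
    have hl2 := l2_mul_mul_eq ((a - b : A) : GaugeConfig 3 L SU2 → ℝ) h
    rw [← hf, hsub0] at hl2
    have : l2 (0 : GaugeConfig 3 L SU2 → ℝ) 0 = 0 := by simp [l2]
    rw [this] at hl2
    linarith
  set W : Submodule ℝ (GaugeConfig 3 L SU2 → ℝ) := LinearMap.range f with hWdef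
  have hW : Module.finrank ℝ W = k + 1 := by rw [hWdef, LinearMap.finrank_range_of_inj hinj, hA]
  have hadm : ∀ ψ ∈ W, IsPhys ψ := by
    rintro ψ ⟨a, rfl⟩; rw [hf]; exact isPhys_mul (hAphys _ a.2) hh
  have hl2W : ∀ ψ ∈ W, ψ ≠ 0 → 0 < l2 ψ ψ := by
    rintro ψ ⟨a, rfl⟩ hne
    have hne' : (a : GaugeConfig 3 L SU2 → ℝ) ≠ 0 := by
      intro h0; apply hne; rw [hf, h0, zero_mul]
    rw [hf, l2_mul_mul_eq]; exact hnd _ a.2 hne'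
  have hs : ∀ ψ ∈ W, (Λ' - δ) * l2 ψ ψ ≤ qform su2Rep β ψ ψ := by
    rintro ψ ⟨a, rfl⟩
    have ha : IsPhys (a : GaugeConfig 3 L SU2 → ℝ) := hAphys _ a.2
    obtain ⟨Ca, hCa⟩ := ha.bounded
    rw [hf, l2_mul_mul_eq]
    have h1 := qform_mul_mul_ge hβ ha.measurable hh.measurable hCa hCh (hdir _ a.2)
    have h2 := hsub _ a.2
    calc (Λ' - δ) * ∫ U, (a : GaugeConfig 3 L SU2 → ℝ) U ^ 2 * h U ^ 2 ∂configMeasure SU2 L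
        = Λ' * (∫ U, (a : GaugeConfig 3 L SU2 → ℝ) U ^ 2 * h U ^ 2 ∂configMeasure SU2 L) -
            δ * ∫ U, (a : GaugeConfig 3 L SU2 → ℝ) U ^ 2 * h U ^ 2 ∂configMeasure SU2 L := by ring
      _ ≤ (∫ U, (a : GaugeConfig 3 L SU2 → ℝ) U ^ 2 * (h U * transferApply β h U) ∂configMeasure SU2 L) -
            δ * ∫ U, (a : GaugeConfig 3 L SU2 → ℝ) U ^ 2 * h U ^ 2 ∂configMeasure SU2 L := by linarith
      _ ≤ qform su2Rep β ((a : GaugeConfig 3 L SU2 → ℝ) * h) ((a : GaugeConfig 3 L SU2 → ℝ) * h) := h1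
  exact le_levelValue_of_subspace su2Rep continuous_su2Rep β W hW hadm hl2W hs

/-! ## §4 From a pointwise subsolution on a bulk set to the integrated (SUB) bound -/

/-- **Integrated subsolution bound from a pointwise one.**  If `h ≥ 0` is bounded measurable, `Λ' ≥ 0`, `Λ'·h ≤ K_βh` on a measurable set
`B`, and the `a²h²`-mass off `B` is at most the fraction `m` of the total, then `Λ'(1 − m)·∫a²h² ≤ ∫ a²·h·(K_βh)`. [folklore] -/
theorem integral_sq_mul_transferApply_ge {β : ℝ} {a h : GaugeConfig 3 L SU2 → ℝ} (ham : Measurable a) (hhm : Measurable h)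
    {Ca Ch : ℝ} (hab : ∀ U, |a U| ≤ Ca) (hhb : ∀ U, |h U| ≤ Ch) (hh0 : ∀ U, 0 ≤ h U)
    {B : Set (GaugeConfig 3 L SU2)} (hB : MeasurableSet B) {Λ' m : ℝ} (hΛ' : 0 ≤ Λ')
    (hsubB : ∀ U ∈ B, Λ' * h U ≤ transferApply β h U)
    (hmass : ∫ U in Bᶜ, a U ^ 2 * h U ^ 2 ∂configMeasure SU2 L ≤ m * ∫ U, a U ^ 2 * h U ^ 2 ∂configMeasure SU2 L) :
    Λ' * (1 - m) * ∫ U, a U ^ 2 * h U ^ 2 ∂configMeasure SU2 L ≤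
      ∫ U, a U ^ 2 * (h U * transferApply β h U) ∂configMeasure SU2 L := by
  haveI : SecondCountableTopology SU2 := secondCountableTopology_su2
  obtain ⟨M, hM⟩ := exists_transferKernel_le su2Rep continuous_su2Rep β (L := L)
  set μ := configMeasure SU2 L with hμ
  have hCa : 0 ≤ Ca := (abs_nonneg _).trans (hab fun _ => 1)
  have hCh : 0 ≤ Ch := (abs_nonneg _).trans (hhb fun _ => 1)
  -- integrability
  have ha2h2m : Measurable fun U => a U ^ 2 * h U ^ 2 := (ham.pow_const 2).mul (hhm.pow_const 2)
  have ha2h2 : Integrable (fun U => a U ^ 2 * h U ^ 2) μ := by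
    refine Integrable.mono' (integrable_const (Ca ^ 2 * Ch ^ 2)) ha2h2m.aestronglyMeasurable (ae_of_all _ fun U => ?_)
    rw [Real.norm_eq_abs, abs_mul, abs_pow, abs_pow]
    exact mul_le_mul (pow_le_pow_left₀ (abs_nonneg _) (hab U) 2) (pow_le_pow_left₀ (abs_nonneg _) (hhb U) 2)
      (by positivity) (by positivity)
  have hKh : ∀ U, |transferApply β h U| ≤ M * Ch := abs_transferApply_le β hM hhm hhb
  have hgm : Measurable fun U => a U ^ 2 * (h U * transferApply β h U) :=
    (ham.pow_const 2).mul (hhm.mul (measurable_transferApply β hhm))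
  have hg : Integrable (fun U => a U ^ 2 * (h U * transferApply β h U)) μ := by
    refine Integrable.mono' (integrable_const (Ca ^ 2 * (Ch * (M * Ch)))) hgm.aestronglyMeasurable (ae_of_all _ fun U => ?_)
    rw [Real.norm_eq_abs, abs_mul, abs_mul, abs_pow]
    exact mul_le_mul (pow_le_pow_left₀ (abs_nonneg _) (hab U) 2) (mul_le_mul (hhb U) (hKh U) (abs_nonneg _) hCh)
      (by positivity) (by positivity)
  have hg0 : ∀ U, 0 ≤ a U ^ 2 * (h U * transferApply β h U) := fun U =>
    mul_nonneg (sq_nonneg _) (mul_nonneg (hh0 U) (transferApply_nonneg β hh0 U))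
  -- restrict to `B`, compare pointwise there
  have h1 : ∫ U in B, a U ^ 2 * (h U * transferApply β h U) ∂μ ≤ ∫ U, a U ^ 2 * (h U * transferApply β h U) ∂μ :=
    setIntegral_le_integral hg (ae_of_all _ hg0)
  have h2 : ∫ U in B, Λ' * (a U ^ 2 * h U ^ 2) ∂μ ≤ ∫ U in B, a U ^ 2 * (h U * transferApply β h U) ∂μ := by
    refine setIntegral_mono_on (hg := hg.integrableOn) ((ha2h2.const_mul Λ').integrableOn) hB fun U hU => ?_
    have := hsubB U hU
    calc Λ' * (a U ^ 2 * h U ^ 2) = a U ^ 2 * (h U * (Λ' * h U)) := by ring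
      _ ≤ a U ^ 2 * (h U * transferApply β h U) :=
          mul_le_mul_of_nonneg_left (mul_le_mul_of_nonneg_left this (hh0 U)) (sq_nonneg _)
  have h3 : ∫ U in B, Λ' * (a U ^ 2 * h U ^ 2) ∂μ = Λ' * ((∫ U, a U ^ 2 * h U ^ 2 ∂μ) - ∫ U in Bᶜ, a U ^ 2 * h U ^ 2 ∂μ) := by
    rw [integral_const_mul, ← integral_add_compl hB ha2h2]; ring
  rw [h3] at h2
  have h4 : Λ' * ((∫ U, a U ^ 2 * h U ^ 2 ∂μ) - m * ∫ U, a U ^ 2 * h U ^ 2 ∂μ) ≤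
      Λ' * ((∫ U, a U ^ 2 * h U ^ 2 ∂μ) - ∫ U in Bᶜ, a U ^ 2 * h U ^ 2 ∂μ) :=
    mul_le_mul_of_nonneg_left (by linarith) hΛ'
  calc Λ' * (1 - m) * ∫ U, a U ^ 2 * h U ^ 2 ∂μ = Λ' * ((∫ U, a U ^ 2 * h U ^ 2 ∂μ) - m * ∫ U, a U ^ 2 * h U ^ 2 ∂μ) := by ring
    _ ≤ ∫ U, a U ^ 2 * (h U * transferApply β h U) ∂μ := h4.trans (h2.trans h1)

/-! ## §5 The reduction of `hLow` (COARSE-LOWER(L₁)) to the two doors -/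

/-- Ratio bookkeeping: `λ₀ ≤ Λ`, `Λ' − δ ≤ λ_k`, `r·Λ ≤ Λ' − δ`, `0 ≤ r` give `r·λ₀ ≤ λ_k`. [folklore] -/
theorem ratio_lower_of_doors {lam0v lamk Λ Λ' δ r : ℝ} (h0 : lam0v ≤ Λ) (hk : Λ' - δ ≤ lamk) (hr : r * Λ ≤ Λ' - δ) (hr0 : 0 ≤ r) :
    r * lam0v ≤ lamk := (mul_le_mul_of_nonneg_left h0 hr0).trans (hr.trans hk)

/-- ★ **COARSE-LOWER(L₁) from the doors** — conclusion = VERBATIM the hypothesis `hLow` of `TwoLattice.Base.fixedLatticeTraceLaw_of_coarse L1`.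
Input: for every level `k` and `ε > 0`, deep in the femto window at lattice size `L₁`, three numbers `Λ, Λ', δ` with `λ₀ ≤ Λ` (§1 from a
supersolution), `Λ' − δ ≤ λ_k` (§3 from the ground-state transform) and `e^{−(Δ_k+ε)Λ(β,L₁)/L₁}·Λ ≤ Λ' − δ` (the semiclassical content:
`Λ'/Λ = e^{−o(u)}`, `δ/Λ ≤ (Δ_k + o(1))u`). [cite: Luscher1983, §3] [cite: ReedSimonIV1978, Thm. XIII.1–2] -/
theorem coarseLower_of_doors (L1 : ℕ) [NeZero L1]
    (hdoors : ∀ k : ℕ, ∀ ε : ℝ, 0 < ε → ∃ lam0 : ℝ, 0 < lam0 ∧ ∀ lam : ℝ, 0 < lam → lam ≤ lam0 →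
      ∀ β : ℝ, InFemtoWindow lam β L1 → ∃ Λ Λ' δ : ℝ,
        levelValue su2Rep L1 β 0 ≤ Λ ∧ Λ' - δ ≤ levelValue su2Rep L1 β k ∧
          Real.exp (-((levelGap k + ε) * luscherLambda β L1) / L1) * Λ ≤ Λ' - δ) :
    ∀ k : ℕ, ∀ ε : ℝ, 0 < ε → ∃ lam0 : ℝ, 0 < lam0 ∧ ∀ lam : ℝ, 0 < lam → lam ≤ lam0 →
      ∀ β : ℝ, InFemtoWindow lam β L1 →
        Real.exp (-((levelGap k + ε) * luscherLambda β L1) / L1) * levelValue su2Rep L1 β 0 ≤ levelValue su2Rep L1 β k := by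
  intro k ε hε
  obtain ⟨lam0, hlam0, H⟩ := hdoors k ε hε
  refine ⟨lam0, hlam0, fun lam hlam hle β hW => ?_⟩
  obtain ⟨Λ, Λ', δ, h0, hk, hr⟩ := H lam hlam hle β hW
  exact ratio_lower_of_doors h0 hk hr (Real.exp_pos _).le

end Summit.QuantumFields.YangMills.Theorems.FemtoTransferGap.TwoLattice.Lower

end
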